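import Literature.MathematicalPhysics.QuantumFieldTheory.Balaban1983to89.T4RelativeLadder

/-!
# `Balaban1983to89.B9Eq340LadderHolonomy` — T. Bałaban, *Propagators for lattice gauge theories in a background field*, Commun. Math. Phys. **99** (1985) 389–434
# [Balaban1985BackgroundPropagators], (3.40) p. 397 with (3.35) p. 396: THE NON-ABELIAN STOKES BOUND FOR A LADDER — the holonomy of the loop «contour Γ, one rung,
# the translated contour Γ + e_κ backwards, the rung back» is within `Σ_rungs |U(∂p) − 1|` of `1` for unitary-like bond variables

statement-level skeleton of published theorems with citation tags; proofs where landed; nothing here is a claim about the Yang–Mills mass gap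

THE PRINT.  p. 397, (3.40): the covariant Hölder quotients `|R(U(Γ_{x,x′}))λ(x′) − λ(x)|` along «a shortest contour Γ_{x,x′}»; p. 396 (3.35): the plaquette variables are
small on the cubes of the class («U^u = e^{iηA}, |∇^ηA| < O(1)Mα₀(Lʲη)⁻²»; at def-Y's letters: n06-j's `B9Eq335PlaquetteAtLettersY.norm_holY_sub_one_le_of_reg335Cube`).
The covariant DIFFERENCE of a transported test function between neighbouring bonds is governed by the holonomy of the thin loop between the two transport contours —
a LADDER of plaquettes; this file is the abstract telescoping estimate for such loops (the [Balaban1985Averaging] (44)–(47) chain count, non-abelian form).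

WHY THIS FILE (dag-n06-i gen 13, N06 bundle F4, row 26, step F-b of the (P′1) roadmap in `pub-ymgap-dag-n06-i/HANDOFF.md`).  The energy bound (P′1) for the
transported tent bumps (`B9Eq3132CoerciveFromEnergy.hco26_of_energy_step12`'s one displayed binder) needs `‖τ(z)·U_κ(z)·τ(z+e_κ)⁻¹ − 1‖ = O(Mα₀·L⁻ʲ)` for
def-Y's taxicab transporters `τ`; the two contours differ by a ladder of `≤ d·2Lʲ` rungs, each plaquette `O(Mα₀L^{−2j})`-close to `1`.

WHAT IS PROVED (sorry-free).  Abstract data in a normed ring `R`: bottom bonds `h`, top bonds `h′`, rungs `v : ℕ → Rˣ`.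
* §1 `contourProd h n = h 0 · h 1 ⋯ h (n−1)` (`contourProd_succ`), `UnitaryLike` is inherited (`unitaryLike_contourProd`).
* §2 `rungPlaq h h′ v m := h m · v (m+1) · (h′ m)⁻¹ · (v m)⁻¹` (the m-th plaquette word), `ladderHol h h′ v n := contourProd h n · v n · (contourProd h′ n)⁻¹ · (v 0)⁻¹`,
  ★ `ladderHol_succ` — `ladderHol (n+1) = (contourProd h n · rungPlaq n · (contourProd h n)⁻¹) · ladderHol n`, `ladderHol_zero = 1`.
* §3 ★★★ `norm_ladderHol_sub_one_le` — for unitary-like `h`, `h′`, `v`: `‖ladderHol n − 1‖ ≤ Σ_{m<n} ‖rungPlaq m − 1‖`; `norm_ladderHol_sub_one_le_mul` (uniform `δ`: `≤ n·δ`);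
  `norm_lasso_sub_one_le` (prefix-conjugate form). (‖V⁻¹ − 1‖ ≤ ‖V − 1‖ for backward steps is the cell's `T4RelativeLadder.norm_inv_sub_one_le`.)

HONEST SCOPE.  Elementary normed-ring algebra (uses the pub-balaban cell's `T4RelativeLadder.UnitaryLike` API by name); the identification of def-Y's `parTaxiV` contours
with such paths (legs, shorter way round, no wrapping inside a block) is NOT done here; nothing of [B9] asserted; count-neutral; N06 NOT discharged.  Cell `pub-ymgap`
(HUMAN RULING D-0062), Track A node N06 [B9], seat `pub-ymgap-dag-n06-i` (gen 13), 2026-08-27; a NEW file.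
-/

namespace Literature.MathematicalPhysics.QuantumFieldTheory.Balaban1983to89.B9Eq340LadderHolonomy

open Finset
open T4RelativeLadder (UnitaryLike norm_conj_sub_one_eq norm_inv_sub_one_le)

variable {R : Type*} [NormedRing R]

/-! ## §1 Ordered products along a contour -/

/-- the ordered product `h 0 · h 1 ⋯ h (n−1)` (the transporter along the first `n` bonds of a contour). [cite: Balaban1985BackgroundPropagators, (3.3) p.391, (3.40) p.397] -/
def contourProd (h : ℕ → Rˣ) : ℕ → Rˣ
  | 0 => 1
  | n + 1 => contourProd h n * h n

/-- `contourProd h 0 = 1`. [cite: Balaban1985BackgroundPropagators, (3.3) p.391, bookkeeping] -/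
@[simp] theorem contourProd_zero (h : ℕ → Rˣ) : contourProd h 0 = 1 := rfl

/-- `contourProd h (n+1) = contourProd h n · h n`. [cite: Balaban1985BackgroundPropagators, (3.3) p.391, bookkeeping] -/
theorem contourProd_succ (h : ℕ → Rˣ) (n : ℕ) : contourProd h (n + 1) = contourProd h n * h n := rfl

/-- products of unitary-like units are unitary-like (G-valued contour transporters). [cite: Balaban1985BackgroundPropagators, (3.40) p.397, bookkeeping] -/
theorem unitaryLike_contourProd [NormOneClass R] {h : ℕ → Rˣ} (hh : ∀ m, UnitaryLike (h m)) (n : ℕ) : UnitaryLike (contourProd h n) := by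
  induction n with
  | zero => exact UnitaryLike.one
  | succ n ih => rw [contourProd_succ]; exact ih.mul (hh n)

/-! ## §2 The ladderHol word and its telescoping -/

/-- the `m`-th RUNG PLAQUETTE `h(m)·v(m+1)·h′(m)⁻¹·v(m)⁻¹` (bottom bond, far rung, top bond backwards, near rung backwards).
[cite: Balaban1985BackgroundPropagators, (3.1) p.390 (plaquette variables)] -/
def rungPlaq (h h' v : ℕ → Rˣ) (m : ℕ) : Rˣ := h m * v (m + 1) * (h' m)⁻¹ * (v m)⁻¹

/-- the LADDER HOLONOMY after `n` bonds: bottom contour, rungPlaq `n` up, top contour backwards, rungPlaq `0` down.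
[cite: Balaban1985BackgroundPropagators, (3.40) p.397, bookkeeping] -/
def ladderHol (h h' v : ℕ → Rˣ) (n : ℕ) : Rˣ := contourProd h n * v n * (contourProd h' n)⁻¹ * (v 0)⁻¹

/-- the empty ladder is trivial. [cite: Balaban1985BackgroundPropagators, (3.40) p.397, bookkeeping] -/
@[simp] theorem ladderHol_zero (h h' v : ℕ → Rˣ) : ladderHol h h' v 0 = 1 := by simp [ladderHol]

/-- ★ **TELESCOPING**: `ladderHol (n+1) = (contourProd h n · rungPlaq n · (contourProd h n)⁻¹) · ladderHol n` — one more rungPlaq is one more plaquette, conjugated by the bottom contour.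
[cite: Balaban1985BackgroundPropagators, (3.40) p.397; Balaban1985Averaging, (44)–(47) pp.24–25 (chain counts), bookkeeping] -/
theorem ladderHol_succ (h h' v : ℕ → Rˣ) (n : ℕ) :
    ladderHol h h' v (n + 1) = (contourProd h n * rungPlaq h h' v n * (contourProd h n)⁻¹) * ladderHol h h' v n := by
  simp only [ladderHol, rungPlaq, contourProd_succ, mul_inv_rev]
  group

/-! ## §3 The non-abelian Stokes bound -/

/-- `‖AB − 1‖ ≤ ‖A − 1‖ + ‖B − 1‖ for units with `‖A‖ ≤ 1` (the chain count). [cite: Balaban1985Averaging, (44)–(47) pp.24–25, bookkeeping] -/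
theorem norm_mul_sub_one_le {A B : Rˣ} (hA : ‖(A : R)‖ ≤ 1) : ‖((A * B : Rˣ) : R) - 1‖ ≤ ‖(A : R) - 1‖ + ‖(B : R) - 1‖ := by
  rw [Units.val_mul]
  have e : (A : R) * (B : R) - 1 = (A : R) * ((B : R) - 1) + ((A : R) - 1) := by noncomm_ring
  rw [e]
  calc _ ≤ ‖(A : R) * ((B : R) - 1)‖ + ‖(A : R) - 1‖ := norm_add_le _ _
    _ ≤ ‖(A : R)‖ * ‖(B : R) - 1‖ + ‖(A : R) - 1‖ := by gcongr; exact norm_mul_le _ _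
    _ ≤ 1 * ‖(B : R) - 1‖ + ‖(A : R) - 1‖ := by gcongr
    _ = ‖(A : R) - 1‖ + ‖(B : R) - 1‖ := by ring

/-- ★★★ **NON-ABELIAN STOKES FOR A LADDER**: for unitary-like bond variables, `‖ladderHol n − 1‖ ≤ Σ_{m<n} ‖rungPlaq m − 1‖` — the holonomy of the thin loop between a
contour and its translate is controlled by the plaquette variables of the rungs it sweeps. [cite: Balaban1985BackgroundPropagators, (3.40) p.397, (3.35) p.396; Balaban1985Averaging, (44)–(47) pp.24–25] -/
theorem norm_ladderHol_sub_one_le [NormOneClass R] {h h' v : ℕ → Rˣ} (hh : ∀ m, UnitaryLike (h m)) (hh' : ∀ m, UnitaryLike (h' m))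
    (hv : ∀ m, UnitaryLike (v m)) (n : ℕ) :
    ‖(ladderHol h h' v n : R) - 1‖ ≤ ∑ m ∈ range n, ‖(rungPlaq h h' v m : R) - 1‖ := by
  induction n with
  | zero => simp
  | succ n ih =>
    rw [ladderHol_succ, sum_range_succ]
    have hP := unitaryLike_contourProd hh n
    have hconj : ‖((contourProd h n * rungPlaq h h' v n * (contourProd h n)⁻¹ : Rˣ) : R) - 1‖ = ‖(rungPlaq h h' v n : R) - 1‖ := by
      rw [Units.val_mul, Units.val_mul]; exact norm_conj_sub_one_eq hP _
    have hA : ‖((contourProd h n * rungPlaq h h' v n * (contourProd h n)⁻¹ : Rˣ) : R)‖ ≤ 1 :=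
      ((hP.mul (((hh n).mul (hv (n + 1))).mul (hh' n).inv |>.mul (hv n).inv)).mul hP.inv).1
    calc _ ≤ ‖((contourProd h n * rungPlaq h h' v n * (contourProd h n)⁻¹ : Rˣ) : R) - 1‖ + ‖(ladderHol h h' v n : R) - 1‖ := norm_mul_sub_one_le hA
      _ ≤ _ := by rw [hconj]; linarith

/-- uniform form: if every rungPlaq plaquette is `δ`-close to `1` then `‖ladderHol n − 1‖ ≤ n·δ`. [cite: Balaban1985BackgroundPropagators, (3.40) p.397, (3.35) p.396] -/
theorem norm_ladderHol_sub_one_le_mul [NormOneClass R] {h h' v : ℕ → Rˣ} (hh : ∀ m, UnitaryLike (h m)) (hh' : ∀ m, UnitaryLike (h' m))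
    (hv : ∀ m, UnitaryLike (v m)) {δ : ℝ} {n : ℕ} (hδ : ∀ m < n, ‖(rungPlaq h h' v m : R) - 1‖ ≤ δ) :
    ‖(ladderHol h h' v n : R) - 1‖ ≤ n * δ := by
  refine (norm_ladderHol_sub_one_le hh hh' hv n).trans ?_
  calc ∑ m ∈ range n, ‖(rungPlaq h h' v m : R) - 1‖ ≤ ∑ m ∈ range n, δ := sum_le_sum fun m hm => hδ m (mem_range.1 hm)
    _ = n * δ := by rw [sum_const, card_range, nsmul_eq_mul]

/-- the LASSO form used for transported test functions: `τ(z)·U_κ(z)·τ′(z)⁻¹` with `τ = (common prefix)·(bottom contour)`, `τ′ = (common prefix)·(rungPlaq 0)·(top contour)`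
is the prefix-conjugate of the ladderHol, so its distance to `1` obeys the same bound. [cite: Balaban1985BackgroundPropagators, (3.40) p.397, bookkeeping] -/
theorem norm_lasso_sub_one_le [NormOneClass R] {h h' v : ℕ → Rˣ} (hh : ∀ m, UnitaryLike (h m)) (hh' : ∀ m, UnitaryLike (h' m))
    (hv : ∀ m, UnitaryLike (v m)) {π : Rˣ} (hπ : UnitaryLike π) (n : ℕ) :
    ‖(((π * contourProd h n) * v n * (π * v 0 * contourProd h' n)⁻¹ : Rˣ) : R) - 1‖ ≤ ∑ m ∈ range n, ‖(rungPlaq h h' v m : R) - 1‖ := by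
  have e : (π * contourProd h n) * v n * (π * v 0 * contourProd h' n)⁻¹ = π * ladderHol h h' v n * π⁻¹ := by
    simp only [ladderHol, mul_inv_rev]; group
  rw [e, Units.val_mul, Units.val_mul, norm_conj_sub_one_eq hπ]
  exact norm_ladderHol_sub_one_le hh hh' hv n

end Literature.MathematicalPhysics.QuantumFieldTheory.Balaban1983to89.B9Eq340LadderHolonomy
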